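import Summits.RiemannHypothesis.RiemannHypothesis.Theorems.WeilTwoPrimeDeflC83XBase
import Literature.NumberTheory.LFunctions.WeilBlockRows
import HarnessLib

/-!
# Deflated two-prime certificate C83X: rows 0–7 of the even check `D C = I`

`WeilCert.checkDCRow 0` for certificate C83X, by `decide +kernel`. Pure proof file.
-/

set_option linter.dupNamespace false

noncomputable section

namespace Summit.RiemannHypothesis.RiemannHypothesis.Theorems.EvenWinsBeyondArch

open Literature.NumberTheory.LFunctions

set_option maxHeartbeats 0 in
/-- Kernel check of row 0 of the even `D C = I` (certificate C83X). [folklore] -/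
theorem checkDCRow0_0_weilCertDeflC83X : weilCertDeflC83XBase.checkDCRow 0 0 = true := by
  decide +kernel

set_option maxHeartbeats 0 in
/-- Kernel check of row 1 of the even `D C = I` (certificate C83X). [folklore] -/
theorem checkDCRow0_1_weilCertDeflC83X : weilCertDeflC83XBase.checkDCRow 0 1 = true := by
  decide +kernel

set_option maxHeartbeats 0 in
/-- Kernel check of row 2 of the even `D C = I` (certificate C83X). [folklore] -/
theorem checkDCRow0_2_weilCertDeflC83X : weilCertDeflC83XBase.checkDCRow 0 2 = true := by
  decide +kernel

set_option maxHeartbeats 0 in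
/-- Kernel check of row 3 of the even `D C = I` (certificate C83X). [folklore] -/
theorem checkDCRow0_3_weilCertDeflC83X : weilCertDeflC83XBase.checkDCRow 0 3 = true := by
  decide +kernel

set_option maxHeartbeats 0 in
/-- Kernel check of row 4 of the even `D C = I` (certificate C83X). [folklore] -/
theorem checkDCRow0_4_weilCertDeflC83X : weilCertDeflC83XBase.checkDCRow 0 4 = true := by
  decide +kernel

set_option maxHeartbeats 0 in
/-- Kernel check of row 5 of the even `D C = I` (certificate C83X). [folklore] -/
theorem checkDCRow0_5_weilCertDeflC83X : weilCertDeflC83XBase.checkDCRow 0 5 = true := by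
  decide +kernel

set_option maxHeartbeats 0 in
/-- Kernel check of row 6 of the even `D C = I` (certificate C83X). [folklore] -/
theorem checkDCRow0_6_weilCertDeflC83X : weilCertDeflC83XBase.checkDCRow 0 6 = true := by
  decide +kernel

set_option maxHeartbeats 0 in
/-- Kernel check of row 7 of the even `D C = I` (certificate C83X). [folklore] -/
theorem checkDCRow0_7_weilCertDeflC83X : weilCertDeflC83XBase.checkDCRow 0 7 = true := by
  decide +kernel


end Summit.RiemannHypothesis.RiemannHypothesis.Theorems.EvenWinsBeyondArch
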